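import Summits.NavierStokesRegularity.NavierStokesRegularity.Theses.AxisymmetricExtremality
import Summits.NavierStokesRegularity.NavierStokesRegularity.Theorems.AxisymmetricExtremalityAxisymmetricKatoGlobalStubSereginLogSwirlOriginCoreNormaliseRescale
import Summits.NavierStokesRegularity.NavierStokesRegularity.Theorems.AxisymmetricExtremalityAxisymmetricKatoGlobalStubSereginLogSwirlOriginCleanSlabRepr
import HarnessLib

/-!
# Seregin 2022, §2: the hypothesis block (H) of the criterion and the clean-slab data under the
# Navier–Stokes scaling about an axis point of the configuration —
# crux stmt-NavierStokesRegularity-15453 (`AxisymmetricExtremality.AxisymmetricKatoGlobal`), line registered, support for stub `stub_sereginLogSwirlOrigin`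

Support file (`--supports stmt-NavierStokesRegularity-15453`; theorems only, everything proved)
toward the registered stub `stub_sereginLogSwirlOrigin` = the named fact
`Literature.Analysis.FluidPDE.seregin2022_logSwirl_regularAtOrigin` (G. Seregin, J. Math. Fluid
Mech. 24 (2022), Paper 27 = arXiv:2201.00153, §2).  Second of three files normalising the
classical core of the fact (hypothesis `core` of `seregin2022_logSwirl_regularAtOrigin_of_cleanRepr`,
sibling `…FinalReduction`) to the origin at unit scale (sibling `…CoreNormaliseRescale` has the
covariance of the single ingredients, `…CoreNormalise` the normalisation itself).

For a configuration of the core — an axis point `ẑ = (t̂, b e₃)` with `-1/16 < t̂ ≤ 0`,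
`|b| ≤ 1/4`, a scale `0 < R ≤ 1/4` (so `Q(ẑ, R) ⊆ Q = 𝒞 × ]-1, 0[`, `parCyl_config_subset`),
heights `h±` and a width `δ` — and the zoom `Φ(s, y) = (t̂ + R² s, b e₃ + R y)`,
`v_R = R v ∘ Φ`, `q_R = R² q ∘ Φ` (`R • stPull (R²) R t̂ (b • eZ) v`), this file transports:

* the hypothesis block (H) of the fact from `(v, q)` on `Q` to `(v_R, q_R)` on `Q = Φ⁻¹(Q(ẑ, R))`:
  `suitable_axisZoom` (H1, accepted `IsSuitableWeakSolutionOn.stRescale`), `energyClass_axisZoom`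
  (H2, `sup_s ∫_𝒞 |v_R|² ≤ R⁻¹ sup_t ∫_𝒞 |v|²`), `gradClass_axisZoom` (H3, `∇v_R = R² ∇v ∘ Φ`),
  `pressureClass_axisZoom` (H4), `isAxisymmetric_axisZoom`, `isAxisymmetricScalar_axisZoom` (H5–H6,
  `b e₃` is fixed by the rotations), `swirlBound_axisZoom` (H7 = (2.2), registered; the swirl is
  scale invariant and the logarithmic weight monotone, constant `max(C₁, 0)`);
* the clean-slab data: `aeEq_axisZoom` (`v = V` a.e. on `Q(ẑ, R)` ⇒ `v_R = V_R` a.e. on `Q`),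
  `heights_axisZoom` (`h± ↦ (h± - b)/R`, `δ ↦ δ/R`), `derivBounds_axisZoom` (the bounds
  `‖D_xⁿV‖ ≤ Cₙ` on `Q_ρ(t̂, a₀) ⊆ Q(ẑ, R)` at the top-slice points `a₀` off the axis or in the two
  strips become `‖D_yⁿV_R‖ ≤ R^{n+1} Cₙ` on `Q_{ρ/R}(0, a) ⊆ Q`, `a₀ = b e₃ + R a`).

## References

* G. Seregin, J. Math. Fluid Mech. 24 (2022), Paper No. 27 = arXiv:2201.00153, §2, Def. 1.1 and
  (2.2) (arXiv p. 5). [`Seregin2022LocalAxisym`]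
* L. Caffarelli, R. Kohn, L. Nirenberg, Comm. Pure Appl. Math. 35 (1982), §2 (scaling of the
  classes of a suitable weak solution). [`CaffarelliKohnNirenberg1982`]
-/

-- the problem directory repeats the summit name (D-0017); core's `dupNamespace` linter fires
set_option linter.dupNamespace false

noncomputable section

open MeasureTheory Set Function Filter Topology TopologicalSpace Metric
open scoped NNReal ENNReal

namespace Summit.NavierStokesRegularity.NavierStokesRegularity.Theorems.AxisymmetricKatoGlobal.EulerScaling

open Literature.Analysis.FluidPDE Literature.Analysis.FluidPDE.SereginZajaczkowski2007
  Literature.Analysis.FluidPDE.SereginSverak2009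

/-! ### The hypothesis block (H) of the fact under the zoom about an axis point of the configuration -/

section Transport

variable {v : ℝ → EuclideanSpace ℝ (Fin 3) → EuclideanSpace ℝ (Fin 3)} {q : ℝ → EuclideanSpace ℝ (Fin 3) → ℝ}
  {t₀ b R : ℝ}

/-- The slab `Q(ẑ, R)` of a configuration (`-1/16 < t̂ ≤ 0`, `|b| ≤ 1/4`, `0 < R ≤ 1/4`,
`ẑ = (t̂, b e₃)`) lies in `Q = 𝒞 × ]-1, 0[`. [folklore] -/
theorem parCyl_config_subset (ht₀ : t₀ ∈ Ioc (-1 / 16 : ℝ) 0) (hb : |b| ≤ 1 / 4) (hR : 0 < R)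
    (hR4 : R ≤ 1 / 4) :
    parCyl ((t₀, b • eZ) : ℝ × EuclideanSpace ℝ (Fin 3)) R ⊆ parCyl (0 : ℝ × EuclideanSpace ℝ (Fin 3)) 1 :=
  parCyl_subset_unitParCyl_of_config (zc := ((t₀, b • eZ) : ℝ × EuclideanSpace ℝ (Fin 3))) ht₀
    (by simpa using cylRadius_axisAffine le_rfl b (0 : EuclideanSpace ℝ (Fin 3)))
    (by simpa [smul_eZ_apply_two] using hb) hR hR4

/-- The cylinder `𝒞(b e₃, R)` of a configuration lies in `𝒞 = 𝒞(0, 1)`. [folklore] -/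
theorem spaceCyl_config_subset (hb : |b| ≤ 1 / 4) (hR4 : R ≤ 1 / 4) :
    spaceCyl (b • eZ) R ⊆ spaceCyl (0 : EuclideanSpace ℝ (Fin 3)) 1 := by
  intro x hx
  rw [mem_spaceCyl, SereginSverak2009.cylRadius_sub_smul_eZ, smul_eZ_apply_two] at hx
  rw [mem_spaceCyl_zero_iff]
  refine ⟨by linarith [hx.1], ?_⟩
  calc |x 2| = |x 2 - b + b| := by rw [sub_add_cancel]
    _ ≤ |x 2 - b| + |b| := abs_add_le _ _
    _ < 1 := by linarith [hx.2]

/-- The times of `Q(0, 1)` are mapped into `]-1, 0[` by `s ↦ t̂ + R² s`. [folklore] -/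
theorem axisZoom_time_mem (ht₀ : t₀ ∈ Ioc (-1 / 16 : ℝ) 0) (hR : 0 < R) (hR4 : R ≤ 1 / 4) {s : ℝ}
    (hs : s ∈ Ioo (-1 : ℝ) 0) : t₀ + R ^ 2 * s ∈ Ioo (-1 : ℝ) 0 := by
  have hR2 : R ^ 2 ≤ 1 / 16 := by nlinarith
  have h1 : -(R ^ 2) < R ^ 2 * s := by nlinarith [hs.1, sq_pos_of_pos hR]
  have h2 : R ^ 2 * s < 0 := mul_neg_of_pos_of_neg (sq_pos_of_pos hR) hs.2
  exact ⟨by linarith [ht₀.1], by linarith [ht₀.2]⟩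

/-- The space zoom `y ↦ b e₃ + R y` maps `𝒞` into `𝒞` (`|b| ≤ 1/4`, `0 < R ≤ 1/4`). [folklore] -/
theorem axisZoom_space_mem (hb : |b| ≤ 1 / 4) (hR : 0 < R) (hR4 : R ≤ 1 / 4)
    {y : EuclideanSpace ℝ (Fin 3)} (hy : y ∈ spaceCyl (0 : EuclideanSpace ℝ (Fin 3)) 1) :
    b • eZ + R • y ∈ spaceCyl (0 : EuclideanSpace ℝ (Fin 3)) 1 := by
  rw [mem_spaceCyl_zero_iff] at hy ⊢
  rw [cylRadius_axisAffine hR.le, smul_eZ_add_smul_apply_two]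
  have h1 : R * cylRadius y < 1 := by nlinarith [hy.1, cylRadius_nonneg y]
  refine ⟨h1, ?_⟩
  have h2 : |R * y 2| < 1 / 4 := by
    rw [abs_mul, abs_of_pos hR]; nlinarith [hy.2, abs_nonneg (y 2)]
  calc |b + R * y 2| ≤ |b| + |R * y 2| := abs_add_le _ _
    _ < 1 := by linarith

/-- **(H1) under the zoom**: the rescaled pair is a suitable weak solution of the unit-viscosity
system in `Q(0, 1) = Φ⁻¹(Q(ẑ, R))` (accepted `IsSuitableWeakSolutionOn.stRescale`, restriction to
`Q(ẑ, R) ⊆ Q`). [cite: CaffarelliKohnNirenberg1982, §2 (scaling)] -/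
theorem suitable_axisZoom (hsw : IsSuitableWeakSolutionOn (parCylOpens 0 1) 1 0 v q)
    (ht₀ : t₀ ∈ Ioc (-1 / 16 : ℝ) 0) (hb : |b| ≤ 1 / 4) (hR : 0 < R) (hR4 : R ≤ 1 / 4) :
    IsSuitableWeakSolutionOn (parCylOpens 0 1) 1 0 (R • stPull (R ^ 2) R t₀ (b • eZ) v)
      (R ^ 2 • stPull (R ^ 2) R t₀ (b • eZ) q) := by
  have hdom : parCylOpens ((t₀, b • eZ) : ℝ × EuclideanSpace ℝ (Fin 3)) R ≤
      parCylOpens (0 : ℝ × EuclideanSpace ℝ (Fin 3)) 1 := fun z hz => parCyl_config_subset ht₀ hb hR hR4 hz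
  have h0 := (hsw.of_le hdom).stRescale hR hR (by ring : R ^ 2 = R * R) t₀ (b • eZ)
  have hvisc : R * 1 / R = 1 := by field_simp
  have hforce : ((R ^ 2 * R) • stPull (R ^ 2) R t₀ (b • eZ)
      (0 : ℝ → EuclideanSpace ℝ (Fin 3) → EuclideanSpace ℝ (Fin 3))) = 0 := by
    funext s y; simp [stPull]
  rwa [hvisc, hforce, parCylOpens_axisZoom hR] at h0

/-- **(H2) under the zoom**: `v_R ∈ L_{2,∞}(Q)` with `sup ∫_𝒞 |v_R|² ≤ R⁻¹ sup ∫_𝒞 |v|²`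
(`∫_𝒞 |R v(t, b e₃ + R y)|² dy = R² R⁻³ ∫_{𝒞(b e₃, R)} |v(t, x)|² dx`). [folklore] -/
theorem energyClass_axisZoom
    (hA : ∃ C : ℝ≥0, ∀ᵐ t ∂(volume.restrict (Ioo (-1 : ℝ) 0)),
      ∫⁻ x in spaceCyl 0 1, ‖v t x‖ₑ ^ 2 ≤ C)
    (ht₀ : t₀ ∈ Ioc (-1 / 16 : ℝ) 0) (hb : |b| ≤ 1 / 4) (hR : 0 < R) (hR4 : R ≤ 1 / 4) :
    ∃ C : ℝ≥0, ∀ᵐ s ∂(volume.restrict (Ioo (-1 : ℝ) 0)),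
      ∫⁻ y in spaceCyl 0 1, ‖(R • stPull (R ^ 2) R t₀ (b • eZ) v) s y‖ₑ ^ 2 ≤ C := by
  obtain ⟨C, hC⟩ := hA
  have hsubT : Ioo (t₀ + R ^ 2 * (-1)) (t₀ + R ^ 2 * 0) ⊆ Ioo (-1 : ℝ) 0 := by
    intro t ht
    have hR2 : R ^ 2 ≤ 1 / 16 := by nlinarith
    exact ⟨by linarith [ht.1, ht₀.1], by linarith [ht.2, ht₀.2]⟩
  have h2 := ae_restrict_Ioo_comp_time_affine (sq_pos_of_pos hR) t₀ (-1) 0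
    (ae_restrict_of_ae_restrict_of_subset hsubT hC)
  have hsubS : spaceCyl (b • eZ) (R * 1) ⊆ spaceCyl (0 : EuclideanSpace ℝ (Fin 3)) 1 := by
    rw [mul_one]; exact spaceCyl_config_subset hb hR4
  have hC'top : (‖R‖ₑ ^ 2 * (ENNReal.ofReal (R ^ 3)⁻¹ * C) : ℝ≥0∞) ≠ ∞ :=
    ENNReal.mul_ne_top (by simp) (ENNReal.mul_ne_top ENNReal.ofReal_ne_top ENNReal.coe_ne_top)
  refine ⟨(‖R‖ₑ ^ 2 * (ENNReal.ofReal (R ^ 3)⁻¹ * C)).toNNReal, ?_⟩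
  rw [ENNReal.coe_toNNReal hC'top]
  filter_upwards [h2] with s hs
  have e : ∀ y : EuclideanSpace ℝ (Fin 3), ‖(R • stPull (R ^ 2) R t₀ (b • eZ) v) s y‖ₑ ^ 2 =
      ‖R‖ₑ ^ 2 * ‖v (t₀ + R ^ 2 * s) (b • eZ + R • y)‖ₑ ^ 2 := by
    intro y
    rw [smul_stPull_apply, enorm_smul, mul_pow]
  simp_rw [e]
  rw [lintegral_const_mul' _ _ (by simp), ← preimage_spaceCyl_axisAffine hR b 1,
    setLIntegral_preimage_comp_space_affine hR (b • eZ) (fun x => ‖v (t₀ + R ^ 2 * s) x‖ₑ ^ 2)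
      (spaceCyl (b • eZ) (R * 1)), finrank_euclideanSpace_fin]
  gcongr
  exact (lintegral_mono_set hsubS).trans hs

/-- **(H3) under the zoom**: `∇v_R = R² (∇v) ∘ Φ ∈ L₂(Q)` is a weak spatial gradient of `v_R`
(accepted `HasWeakSpatialGradientOn.stRescale`, `∫_Q |∇v_R|² = R⁴ R⁻⁵ ∫_{Q(ẑ,R)} |∇v|²`). [folklore] -/
theorem gradClass_axisZoom
    (hG : ∃ G : ℝ → EuclideanSpace ℝ (Fin 3) → EuclideanSpace ℝ (Fin 3) →L[ℝ] EuclideanSpace ℝ (Fin 3),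
      HasWeakSpatialGradientOn (parCylOpens 0 1) v G ∧
        ∫⁻ z in parCyl 0 1, ENNReal.ofReal (frobeniusNormSq (G z.1 z.2)) < ∞)
    (ht₀ : t₀ ∈ Ioc (-1 / 16 : ℝ) 0) (hb : |b| ≤ 1 / 4) (hR : 0 < R) (hR4 : R ≤ 1 / 4) :
    ∃ G : ℝ → EuclideanSpace ℝ (Fin 3) → EuclideanSpace ℝ (Fin 3) →L[ℝ] EuclideanSpace ℝ (Fin 3),
      HasWeakSpatialGradientOn (parCylOpens 0 1) (R • stPull (R ^ 2) R t₀ (b • eZ) v) G ∧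
        ∫⁻ z in parCyl 0 1, ENNReal.ofReal (frobeniusNormSq (G z.1 z.2)) < ∞ := by
  obtain ⟨G, hG, hfin⟩ := hG
  have hsub := parCyl_config_subset ht₀ hb hR hR4
  have hdom : parCylOpens ((t₀, b • eZ) : ℝ × EuclideanSpace ℝ (Fin 3)) R ≤
      parCylOpens (0 : ℝ × EuclideanSpace ℝ (Fin 3)) 1 := fun z hz => hsub hz
  refine ⟨(R * R) • stPull (R ^ 2) R t₀ (b • eZ) G, ?_, ?_⟩
  · have h := (hG.mono hdom).stRescale R (sq_pos_of_pos hR) hR t₀ (b • eZ)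
    rwa [parCylOpens_axisZoom hR] at h
  · rw [← stAffine_preimage_parCyl_self hR t₀ (b • eZ),
      setLIntegral_frobeniusNormSq_stRescale (sq_pos_of_pos hR) hR, finrank_euclideanSpace_fin]
    exact ENNReal.mul_lt_top (ENNReal.mul_lt_top ENNReal.ofReal_lt_top ENNReal.ofReal_lt_top)
      ((lintegral_mono_set hsub).trans_lt hfin)

/-- **(H4) under the zoom**: `q_R = R² q ∘ Φ ∈ L_{3/2}(Q)` (`∫_Q |q_R|^{3/2} = R³ R⁻⁵ ∫_{Q(ẑ,R)} |q|^{3/2}`).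
[folklore] -/
theorem pressureClass_axisZoom
    (hq : ∫⁻ z in parCyl 0 1, ‖q z.1 z.2‖ₑ ^ (3 / 2 : ℝ) < ∞)
    (ht₀ : t₀ ∈ Ioc (-1 / 16 : ℝ) 0) (hb : |b| ≤ 1 / 4) (hR : 0 < R) (hR4 : R ≤ 1 / 4) :
    ∫⁻ z in parCyl 0 1, ‖(R ^ 2 • stPull (R ^ 2) R t₀ (b • eZ) q) z.1 z.2‖ₑ ^ (3 / 2 : ℝ) < ∞ := by
  have hsub := parCyl_config_subset ht₀ hb hR hR4
  rw [← stAffine_preimage_parCyl_self hR t₀ (b • eZ),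
    setLIntegral_enorm_rpow_stRescale (sq_pos_of_pos hR) hR t₀ (b • eZ) (R ^ 2) q _
      (by norm_num : (0 : ℝ) ≤ 3 / 2), finrank_euclideanSpace_fin]
  refine ENNReal.mul_lt_top (ENNReal.mul_lt_top
    (ENNReal.rpow_lt_top_of_nonneg (by norm_num) enorm_ne_top) ENNReal.ofReal_lt_top) ?_
  exact (lintegral_mono_set hsub).trans_lt hq

/-- **(H5) under the zoom**: the rescaled slices are axisymmetric (`b e₃` is fixed by the linear
rotations about the axis, accepted `isAxisymmetric_rescale`). [folklore] -/
theorem isAxisymmetric_axisZoom (hv_ax : ∀ t ∈ Ioo (-1 : ℝ) 0, IsAxisymmetric (v t))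
    (ht₀ : t₀ ∈ Ioc (-1 / 16 : ℝ) 0) (hR : 0 < R) (hR4 : R ≤ 1 / 4) :
    ∀ s ∈ Ioo (-1 : ℝ) 0, IsAxisymmetric ((R • stPull (R ^ 2) R t₀ (b • eZ) v) s) :=
  fun _ hs => isAxisymmetric_rescale (hv_ax _ (axisZoom_time_mem ht₀ hR hR4 hs)) R b R

/-- **(H6) under the zoom**: the rescaled pressure slices are axisymmetric scalars. [folklore] -/
theorem isAxisymmetricScalar_axisZoom (hq_ax : ∀ t ∈ Ioo (-1 : ℝ) 0, IsAxisymmetricScalar (q t))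
    (ht₀ : t₀ ∈ Ioc (-1 / 16 : ℝ) 0) (hR : 0 < R) (hR4 : R ≤ 1 / 4) :
    ∀ s ∈ Ioo (-1 : ℝ) 0, IsAxisymmetricScalar ((R ^ 2 • stPull (R ^ 2) R t₀ (b • eZ) q) s) := by
  intro s hs θ y
  show R ^ 2 • q (t₀ + R ^ 2 * s) (b • eZ + R • rotZ θ y) = R ^ 2 • q (t₀ + R ^ 2 * s) (b • eZ + R • y)
  rw [← rotZ_smul_eZ_add_smul, hq_ax _ (axisZoom_time_mem ht₀ hR hR4 hs) θ]

/-- **(H7) = (2.2) under the zoom**: the swirl bound of the fact for `v` on `Q` gives the swirl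
bound for `v_R = R v ∘ Φ` on `Q` with constant `max(C₁, 0)` — the swirl `σ = ϱ v_φ` is invariant
under the scaling about an axis point and the weight `ln⁻³(e/ϱ)` is monotone
(`abs_swirl_axisZoom_le`; `Φ` maps `Q` into `Q(ẑ, R) ⊆ Q`).
[cite: Seregin2022LocalAxisym, (2.2) (arXiv:2201.00153 p. 5)] -/
theorem swirlBound_axisZoom : ∀ (v : ℝ → EuclideanSpace ℝ (Fin 3) → EuclideanSpace ℝ (Fin 3)) (t₀ b R : ℝ), t₀ ∈ Ioc (-1 / 16 : ℝ) 0 → |b| ≤ 1 / 4 → 0 < R → R ≤ 1 / 4 → (∃ C₁ : ℝ, ∀ t ∈ Ioo (-1 : ℝ) 0, ∀ x ∈ SereginSverak2009.spaceCyl 0 1, 0 < cylRadius x → |swirl (v t) x| ≤ C₁ / Real.log (Real.exp 1 / cylRadius x) ^ 3) → ∃ C₁ : ℝ, 0 ≤ C₁ ∧ ∀ s ∈ Ioo (-1 : ℝ) 0, ∀ y ∈ SereginSverak2009.spaceCyl 0 1, 0 < cylRadius y → |swirl ((R • stPull (R ^ 2) R t₀ (b • eZ) v) s) y| ≤ C₁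 / Real.log (Real.exp 1 / cylRadius y) ^ 3 := by
  intro v t₀ b R ht₀ hb hR hR4 hσ
  obtain ⟨C₁, hC₁⟩ := hσ
  refine ⟨max C₁ 0, le_max_right _ _, fun s hs y hy hy0 => ?_⟩
  have hy1 : cylRadius y < 1 := (mem_spaceCyl_zero_iff.1 hy).1
  have hx : b • eZ + R • y ∈ spaceCyl (0 : EuclideanSpace ℝ (Fin 3)) 1 := axisZoom_space_mem hb hR hR4 hy
  have hx0 : 0 < cylRadius (b • eZ + R • y) := by
    rw [cylRadius_axisAffine hR.le]; positivity
  exact abs_swirl_axisZoom_le hR (by linarith) hy0 hy1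
    (hC₁ _ (axisZoom_time_mem ht₀ hR hR4 hs) _ hx hx0)

/-- **`v = V` a.e. on `Q(ẑ, R)` becomes `v_R = V_R` a.e. on `Q(0, 1)`** (the zoom is a
measure-scaling bijection, accepted `ae_eq_restrict_comp_stAffine`). [folklore] -/
theorem aeEq_axisZoom {V : ℝ → EuclideanSpace ℝ (Fin 3) → EuclideanSpace ℝ (Fin 3)} (hR : 0 < R)
    (hae : uncurry v =ᵐ[volume.restrict (parCyl ((t₀, b • eZ) : ℝ × EuclideanSpace ℝ (Fin 3)) R)] uncurry V) :
    uncurry (R • stPull (R ^ 2) R t₀ (b • eZ) v) =ᵐ[volume.restrict (parCyl (0 : ℝ × EuclideanSpace ℝ (Fin 3)) 1)]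
      uncurry (R • stPull (R ^ 2) R t₀ (b • eZ) V) := by
  have h := ae_eq_restrict_comp_stAffine (sq_pos_of_pos hR) hR t₀ (b • eZ) hae
  rw [stAffine_preimage_parCyl_self hR] at h
  filter_upwards [h] with z hz
  rcases z with ⟨s, y⟩
  have hz' : v (t₀ + R ^ 2 * s) (b • eZ + R • y) = V (t₀ + R ^ 2 * s) (b • eZ + R • y) := hz
  show R • v (t₀ + R ^ 2 * s) (b • eZ + R • y) = R • V (t₀ + R ^ 2 * s) (b • eZ + R • y)
  rw [hz']

/-- The heights and the width of the configuration under the zoom: `h± ↦ (h± - b)/R`, `δ ↦ δ/R`.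
[folklore] -/
theorem heights_axisZoom {hp hm δ : ℝ} (hR : 0 < R) (hδ : 0 < δ) (h1 : b - R ≤ hm - δ)
    (h2 : hm + δ < b) (h3 : b < hp - δ) (h4 : hp + δ ≤ b + R) :
    0 < δ / R ∧ -1 ≤ (hm - b) / R - δ / R ∧ (hm - b) / R + δ / R < 0 ∧ 0 < (hp - b) / R - δ / R ∧
      (hp - b) / R + δ / R ≤ 1 := by
  refine ⟨div_pos hδ hR, ?_, ?_, ?_, ?_⟩
  · rw [← sub_div, le_div_iff₀ hR]; linarith
  · rw [← add_div, div_lt_iff₀ hR]; linarith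
  · rw [← sub_div, lt_div_iff₀ hR]; linarith
  · rw [← add_div, div_le_iff₀ hR]; linarith

/-- `|b + R a₃ - h| < δ` iff `|a₃ - (h - b)/R| < δ/R` (`R > 0`). [folklore] -/
theorem abs_sub_height_lt_iff {a h δ : ℝ} (hR : 0 < R) :
    |a - (h - b) / R| < δ / R ↔ |b + R * a - h| < δ := by
  have e : a - (h - b) / R = (b + R * a - h) / R := by field_simp; ring
  rw [e, abs_div, abs_of_pos hR, div_lt_div_iff_of_pos_right hR]

open scoped ContDiff in
/-- **The derivative bounds up to the top time under the zoom.** If at every top-slice point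
`a₀ ∈ 𝒞(b e₃, R)` off the axis or of height within `δ` of `h₊` or `h₋` the derivatives `D_xⁿV` are
bounded on some `Q_ρ(t̂, a₀) ⊆ Q(ẑ, R)`, then at every `a ∈ 𝒞` off the axis or of height within
`δ/R` of `(h± - b)/R` the derivatives of `V_R = R V ∘ Φ` are bounded on `Q_{ρ/R}(0, a) ⊆ Q(0, 1)`
(`a₀ = b e₃ + R a`, `D_yⁿV_R = R (DⁿV ∘ Φ) ∘ (R id)^{⊗n}`, `‖D_yⁿV_R‖ ≤ R^{n+1} Cₙ`).
[cite: Seregin2022LocalAxisym, §2 Step 1 (arXiv:2201.00153 p. 5)] -/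
theorem derivBounds_axisZoom {V : ℝ → EuclideanSpace ℝ (Fin 3) → EuclideanSpace ℝ (Fin 3)} {hp hm δ : ℝ}
    (hR : 0 < R)
    (hV : ∀ z ∈ parCyl ((t₀, b • eZ) : ℝ × EuclideanSpace ℝ (Fin 3)) R, ContDiffAt ℝ ∞ (V z.1) z.2)
    (hbd : ∀ a ∈ spaceCyl (b • eZ) R, (0 < cylRadius a ∨ |a 2 - hp| < δ ∨ |a 2 - hm| < δ) →
      ∃ ρ > 0, parabolicCylinder ρ ((t₀, a) : ℝ × EuclideanSpace ℝ (Fin 3)) ⊆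
          parCyl ((t₀, b • eZ) : ℝ × EuclideanSpace ℝ (Fin 3)) R ∧
        ∀ n : ℕ, ∃ C : ℝ, ∀ w ∈ parabolicCylinder ρ ((t₀, a) : ℝ × EuclideanSpace ℝ (Fin 3)),
          ‖iteratedFDeriv ℝ n (V w.1) w.2‖ ≤ C) :
    ∀ a ∈ spaceCyl (0 : EuclideanSpace ℝ (Fin 3)) 1,
      (0 < cylRadius a ∨ |a 2 - (hp - b) / R| < δ / R ∨ |a 2 - (hm - b) / R| < δ / R) →
      ∃ ρ > 0, parabolicCylinder ρ (((0 : ℝ), a) : ℝ × EuclideanSpace ℝ (Fin 3)) ⊆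
          parCyl (0 : ℝ × EuclideanSpace ℝ (Fin 3)) 1 ∧
        ∀ n : ℕ, ∃ C : ℝ, ∀ w ∈ parabolicCylinder ρ (((0 : ℝ), a) : ℝ × EuclideanSpace ℝ (Fin 3)),
          ‖iteratedFDeriv ℝ n ((R • stPull (R ^ 2) R t₀ (b • eZ) V) w.1) w.2‖ ≤ C := by
  intro a ha hcond
  have ha₀ : b • eZ + R • a ∈ spaceCyl (b • eZ) R := axisZoom_mem_spaceCyl hR b ha
  have hcond₀ : 0 < cylRadius (b • eZ + R • a) ∨ |(b • eZ + R • a) 2 - hp| < δ ∨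
      |(b • eZ + R • a) 2 - hm| < δ := by
    rcases hcond with h | h | h
    · left; rw [cylRadius_axisAffine hR.le]; positivity
    · right; left; rw [smul_eZ_add_smul_apply_two]; exact (abs_sub_height_lt_iff hR).1 h
    · right; right; rw [smul_eZ_add_smul_apply_two]; exact (abs_sub_height_lt_iff hR).1 h
  obtain ⟨ρ, hρ, hsub, hC⟩ := hbd _ ha₀ hcond₀
  have hpc := stAffine_preimage_parabolicCylinder_axisZoom hR t₀ (b • eZ) a ρ
  refine ⟨ρ / R, div_pos hρ hR, ?_, fun n => ?_⟩
  · rw [← hpc, ← stAffine_preimage_parCyl_self hR t₀ (b • eZ)]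
    exact preimage_mono hsub
  · obtain ⟨C, hC⟩ := hC n
    refine ⟨|R| * |R| ^ n * C, fun w hw => ?_⟩
    have hw' : stAffine (R ^ 2) R t₀ (b • eZ) w ∈
        parabolicCylinder ρ ((t₀, b • eZ + R • a) : ℝ × EuclideanSpace ℝ (Fin 3)) := by
      rw [← mem_preimage, hpc]; exact hw
    have hVw : ContDiffAt ℝ ∞ (V (t₀ + R ^ 2 * w.1)) (b • eZ + R • w.2) :=
      hV (stAffine (R ^ 2) R t₀ (b • eZ) w) (hsub hw')
    have hCw : ‖iteratedFDeriv ℝ n (V (t₀ + R ^ 2 * w.1)) (b • eZ + R • w.2)‖ ≤ C :=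
      hC (stAffine (R ^ 2) R t₀ (b • eZ) w) hw'
    have hformula := iteratedFDeriv_smul_comp_axisZoom hR.ne' R (V (t₀ + R ^ 2 * w.1)) (b • eZ) w.2 n hVw
    have e : (R • stPull (R ^ 2) R t₀ (b • eZ) V) w.1 =
        fun x' => R • V (t₀ + R ^ 2 * w.1) (b • eZ + R • x') := rfl
    rw [e, hformula]
    calc ‖R • (iteratedFDeriv ℝ n (V (t₀ + R ^ 2 * w.1)) (b • eZ + R • w.2)).compContinuousLinearMap
          (fun _ => R • ContinuousLinearMap.id ℝ (EuclideanSpace ℝ (Fin 3)))‖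
        ≤ |R| * |R| ^ n * ‖iteratedFDeriv ℝ n (V (t₀ + R ^ 2 * w.1)) (b • eZ + R • w.2)‖ :=
          norm_smul_compContinuousLinearMap_smul_id_le R R _
      _ ≤ |R| * |R| ^ n * C := mul_le_mul_of_nonneg_left hCw (by positivity)

end Transport


end Summit.NavierStokesRegularity.NavierStokesRegularity.Theorems.AxisymmetricKatoGlobal.EulerScaling

end
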